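import Literature.Analysis.FluidPDE.ElgindiHkClosure
import HarnessLib

/-!
# The integration-by-parts step of the transport estimates
([Elgindi2021] §8.1 Lemmas 8.7–8.8; [ElgindiGhoulMasmoudi2021] §9 Proposition 9.4)

Topic `Literature/Analysis/FluidPDE`. Proof file (everything proved, no definitions, no named
facts) on the proof path of the named fact
`Literature.Analysis.FluidPDE.Elgindi.ElgindiGhoulMasmoudi2021_stabilityCore`
(`ElgindiStabilityDecomposition.lean`). T. M. Elgindi, Ann. of Math. 194 (2021) =
arXiv:1904.04795, §8.1 proof of Lemma 8.7 (p. 26): the top-order term of `(fD_θg, g)_{𝓗⁴}` is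
`½(D_θ((D^ag)²), fW²)_{L²}`, integrated by parts; Elgindi–Ghoul–Masmoudi, arXiv:1910.14071, §9
Proposition 9.4 (p. 20).

For test functions `Z`, `u` of the strip and the weight `w²sin(2θ)^{−c}`:
`∫∫ u·D_θZ·Z·w²s^{−c} = −½∫∫ Z²w²s^{−c}(2(1−c)cos(2θ)u + D_θu)` (`integral_transport_Dθ`) and
`∫∫ v·D_zZ·Z·w²s^{−c} = −½∫∫ Z²w²s^{−c}(D_zv − (1+3z)/(1+z)·v)` (`integral_transport_Dz`), whence
the bounds by `(sup|u| + sup|D_θu|)·∫∫Z²w²s^{−c}` (`abs_integral_transport_Dθ_le`,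
`abs_integral_transport_Dz_le`).
-/

noncomputable section

open MeasureTheory Set Function Real Filter
open _root_.Topology
open scoped ENNReal ContDiff

namespace Literature.Analysis.FluidPDE

namespace Elgindi

/-! ### Test functions times strip-smooth functions; vanishing of total derivatives -/

namespace StripTest

variable {f : ℝ → ℝ → ℝ} (hf : StripTest f)
include hf

/-- A test function times a function smooth on the strip is a test function. [folklore] -/
theorem mulOn {φ : ℝ × ℝ → ℝ} (hφ : ContDiffOn ℝ ∞ φ strip) : StripTest fun z θ => f z θ * φ (z, θ) := by
  have hsm : ContDiff ℝ ∞ (uncurry fun z θ => f z θ * φ (z, θ)) :=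
    Literature.Analysis.Distribution.contDiff_mul_of_tsupport_subset isOpen_strip (contDiff_infty.2 hf.smooth) hf.sub hφ
  have hsupp : support (uncurry fun z θ => f z θ * φ (z, θ)) ⊆ tsupport (uncurry f) := fun p hp => by
    rw [mem_support] at hp
    exact subset_tsupport _ (mem_support.2 (left_ne_zero_of_mul hp))
  refine ⟨fun n => hsm.of_le (by exact_mod_cast le_top), HasCompactSupport.of_support_subset_isCompact hf.supp.isCompact hsupp, ?_⟩
  exact (closure_minimal hsupp (isClosed_tsupport _)).trans hf.sub

/-- `∫∫_strip ∂_θf = 0` for a test function. [folklore] -/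
theorem integral_dθ_eq_zero : ∫ p in strip, dθ f p.1 p.2 = 0 := by
  have hf1 : ContDiff ℝ 1 (uncurry f) := hf.smooth 1
  have h0 : ∀ p, p ∉ strip → dθ f p.1 p.2 = 0 := fun p hp => by
    have hp' : p ∉ tsupport (uncurry (dθ f)) := fun h => hp (hf.sub (tsupport_dθ_subset' f h))
    have := image_eq_zero_of_notMem_tsupport hp'; exact this
  rw [setIntegral_eq_integral_of_forall_compl_eq_zero fun p hp => h0 p hp]
  have cd : Continuous fun p : ℝ × ℝ => dθ f p.1 p.2 := (contDiff_dθ_of_contDiff (n := 0) hf1).continuous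
  have iS : Integrable fun p : ℝ × ℝ => dθ f p.1 p.2 := cd.integrable_of_hasCompactSupport (hasCompactSupport_dθ_of hf.supp)
  rw [Measure.volume_eq_prod, integral_prod _ (by simpa [Measure.volume_eq_prod] using iS)]
  refine integral_eq_zero_of_ae (ae_of_all _ fun R => ?_)
  obtain ⟨h1, h2, -⟩ := hf.slice_θ R
  have hd : ∀ θ, HasDerivAt (fun θ' => f R θ') (dθ f R θ) θ := fun θ => ((h1.differentiable (by simp)) θ).hasDerivAt
  show ∫ θ, dθ f R θ = 0
  have h0 : Tendsto (fun θ' => f R θ') (cocompact ℝ) (𝓝 0) := h2.is_zero_at_infty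
  have hi : Integrable fun θ => dθ f R θ := (h1.continuous_deriv le_rfl).integrable_of_hasCompactSupport h2.deriv
  have := integral_of_hasDerivAt_of_tendsto hd hi (h0.mono_left atBot_le_cocompact) (h0.mono_left atTop_le_cocompact)
  rw [sub_zero] at this
  exact this

/-- `∫∫_strip ∂_Rf = 0` for a test function. [folklore] -/
theorem integral_dz_eq_zero : ∫ p in strip, dz f p.1 p.2 = 0 := by
  have hf1 : ContDiff ℝ 1 (uncurry f) := hf.smooth 1
  have h0 : ∀ p, p ∉ strip → dz f p.1 p.2 = 0 := fun p hp => by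
    have hp' : p ∉ tsupport (uncurry (dz f)) := fun h => hp (hf.sub (tsupport_dz_subset h))
    have := image_eq_zero_of_notMem_tsupport hp'; exact this
  rw [setIntegral_eq_integral_of_forall_compl_eq_zero fun p hp => h0 p hp]
  have cd : Continuous fun p : ℝ × ℝ => dz f p.1 p.2 := (contDiff_dz_of_contDiff (n := 0) hf1).continuous
  have hsd : HasCompactSupport fun p : ℝ × ℝ => dz f p.1 p.2 :=
    HasCompactSupport.of_support_subset_isCompact hf.supp.isCompact fun p hp => tsupport_dz_subset (subset_tsupport _ hp)
  have iS : Integrable fun p : ℝ × ℝ => dz f p.1 p.2 := cd.integrable_of_hasCompactSupport hsd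
  -- integrate in `R` first (swap the product)
  rw [Measure.volume_eq_prod, integral_prod_symm _ (by simpa [Measure.volume_eq_prod] using iS)]
  refine integral_eq_zero_of_ae (ae_of_all _ fun θ => ?_)
  obtain ⟨h1, h2, -⟩ := hf.slice_z θ
  have hd : ∀ z, HasDerivAt (fun z' => f z' θ) (dz f z θ) z := fun z => ((h1.differentiable (by simp)) z).hasDerivAt
  show ∫ z, dz f z θ = 0
  have h0' : Tendsto (fun z' => f z' θ) (cocompact ℝ) (𝓝 0) := h2.is_zero_at_infty
  have hi : Integrable fun z => dz f z θ := (h1.continuous_deriv le_rfl).integrable_of_hasCompactSupport h2.deriv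
  have := integral_of_hasDerivAt_of_tendsto hd hi (h0'.mono_left atBot_le_cocompact) (h0'.mono_left atTop_le_cocompact)
  rw [sub_zero] at this
  exact this

/-- Test functions are integrable. [folklore] -/
theorem integrable : Integrable fun p : ℝ × ℝ => f p.1 p.2 :=
  (hf.smooth 0).continuous.integrable_of_hasCompactSupport hf.supp

/-- Closure under `∂_R`. [folklore] -/
theorem ofdz : StripTest (dz f) :=
  ⟨fun n => contDiff_dz_of_contDiff (hf.smooth (n + 1)), hasCompactSupport_dz hf.supp, tsupport_dz_subset.trans hf.sub⟩

end StripTest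

/-! ### The two integration-by-parts identities -/

/-- **`θ`-integration by parts against a strip-smooth multiplier**: `∫∫ Z∂_θZ·ψ = −½∫∫ Z²∂_θψ` for a
test function `Z` and `ψ ∈ C^∞(strip)` (curried). [folklore] -/
theorem integral_mul_dθ_mul_eq {Z : ℝ → ℝ → ℝ} (hZ : StripTest Z) {ψ : ℝ → ℝ → ℝ} (hψ : ContDiffOn ℝ ∞ (uncurry ψ) strip) :
    ∫ p in strip, Z p.1 p.2 * dθ Z p.1 p.2 * ψ p.1 p.2 = -(1 / 2) * ∫ p in strip, Z p.1 p.2 ^ 2 * dθ ψ p.1 p.2 := by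
  have hdψ : ContDiffOn ℝ ∞ (uncurry (dθ ψ)) strip := contDiffOn_dθ_strip hψ
  -- `H = Z²ψ` is a test function with `∂_θH = 2Z∂_θZψ + Z²∂_θψ` on the strip
  have hH : StripTest fun z θ => (Z * Z) z θ * uncurry ψ (z, θ) := (hZ.mul hZ).mulOn hψ
  have h1 : StripTest fun z θ => (Z * dθ Z) z θ * uncurry ψ (z, θ) := (hZ.mul hZ.ofdθ).mulOn hψ
  have h2 : StripTest fun z θ => (Z * Z) z θ * uncurry (dθ ψ) (z, θ) := (hZ.mul hZ).mulOn hdψ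
  have hder : ∀ p ∈ strip, dθ (fun z θ => (Z * Z) z θ * uncurry ψ (z, θ)) p.1 p.2 =
      2 * ((Z * dθ Z) p.1 p.2 * uncurry ψ (p.1, p.2)) + (Z * Z) p.1 p.2 * uncurry (dθ ψ) (p.1, p.2) := by
    intro p hp
    have hZd : HasDerivAt (fun θ' => Z p.1 θ') (dθ Z p.1 p.2) p.2 := (((hZ.slice_θ p.1).1.differentiable (by simp)) p.2).hasDerivAt
    have hψ1 : ContDiffOn ℝ 1 (uncurry ψ) strip := hψ.of_le (by exact_mod_cast le_top)
    have hψd : HasDerivAt (fun θ' => ψ p.1 θ') (dθ ψ p.1 p.2) p.2 := by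
      have := hasDerivAt_slice_snd (differentiableAt_of_contDiffOn_strip hψ1 one_ne_zero hp)
      rwa [← dθ_eq_fderiv (differentiableAt_of_contDiffOn_strip hψ1 one_ne_zero hp)] at this
    have hprod : HasDerivAt (fun θ' => (Z p.1 θ' * Z p.1 θ') * ψ p.1 θ') ((dθ Z p.1 p.2 * Z p.1 p.2 + Z p.1 p.2 * dθ Z p.1 p.2) * ψ p.1 p.2 + (Z p.1 p.2 * Z p.1 p.2) * dθ ψ p.1 p.2) p.2 :=
      (hZd.mul hZd).mul hψd
    show deriv (fun θ' => (Z p.1 θ' * Z p.1 θ') * ψ p.1 θ') p.2 = _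
    rw [hprod.deriv]
    simp only [Pi.mul_apply, uncurry_apply_pair]
    ring
  have h0 := hH.integral_dθ_eq_zero
  rw [setIntegral_congr_fun measurableSet_strip hder, integral_add (h1.integrable.const_mul 2).integrableOn h2.integrable.integrableOn,
    MeasureTheory.integral_const_mul] at h0
  have e1 : ∫ p in strip, Z p.1 p.2 * dθ Z p.1 p.2 * ψ p.1 p.2 = ∫ p in strip, (Z * dθ Z) p.1 p.2 * uncurry ψ (p.1, p.2) :=
    setIntegral_congr_fun measurableSet_strip fun p _ => by simp only [Pi.mul_apply, uncurry_apply_pair]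
  have e2 : ∫ p in strip, Z p.1 p.2 ^ 2 * dθ ψ p.1 p.2 = ∫ p in strip, (Z * Z) p.1 p.2 * uncurry (dθ ψ) (p.1, p.2) :=
    setIntegral_congr_fun measurableSet_strip fun p _ => by simp only [Pi.mul_apply, uncurry_apply_pair, sq]
  rw [e1, e2]
  linarith

/-- **`R`-integration by parts against a strip-smooth multiplier**: `∫∫ Z∂_RZ·ψ = −½∫∫ Z²∂_Rψ`. [folklore] -/
theorem integral_mul_dz_mul_eq {Z : ℝ → ℝ → ℝ} (hZ : StripTest Z) {ψ : ℝ → ℝ → ℝ} (hψ : ContDiffOn ℝ ∞ (uncurry ψ) strip) :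
    ∫ p in strip, Z p.1 p.2 * dz Z p.1 p.2 * ψ p.1 p.2 = -(1 / 2) * ∫ p in strip, Z p.1 p.2 ^ 2 * dz ψ p.1 p.2 := by
  have hdψ : ContDiffOn ℝ ∞ (uncurry (dz ψ)) strip := contDiffOn_dz_strip hψ
  have hH : StripTest fun z θ => (Z * Z) z θ * uncurry ψ (z, θ) := (hZ.mul hZ).mulOn hψ
  have h1 : StripTest fun z θ => (Z * dz Z) z θ * uncurry ψ (z, θ) := (hZ.mul hZ.ofdz).mulOn hψ
  have h2 : StripTest fun z θ => (Z * Z) z θ * uncurry (dz ψ) (z, θ) := (hZ.mul hZ).mulOn hdψ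
  have hder : ∀ p ∈ strip, dz (fun z θ => (Z * Z) z θ * uncurry ψ (z, θ)) p.1 p.2 =
      2 * ((Z * dz Z) p.1 p.2 * uncurry ψ (p.1, p.2)) + (Z * Z) p.1 p.2 * uncurry (dz ψ) (p.1, p.2) := by
    intro p hp
    have hZd : HasDerivAt (fun z' => Z z' p.2) (dz Z p.1 p.2) p.1 := (((hZ.slice_z p.2).1.differentiable (by simp)) p.1).hasDerivAt
    have hψ1 : ContDiffOn ℝ 1 (uncurry ψ) strip := hψ.of_le (by exact_mod_cast le_top)
    have hψd : HasDerivAt (fun z' => ψ z' p.2) (dz ψ p.1 p.2) p.1 := by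
      have := hasDerivAt_slice_fst (differentiableAt_of_contDiffOn_strip hψ1 one_ne_zero hp)
      rwa [← dz_eq_fderiv (differentiableAt_of_contDiffOn_strip hψ1 one_ne_zero hp)] at this
    have hprod : HasDerivAt (fun z' => (Z z' p.2 * Z z' p.2) * ψ z' p.2) ((dz Z p.1 p.2 * Z p.1 p.2 + Z p.1 p.2 * dz Z p.1 p.2) * ψ p.1 p.2 + (Z p.1 p.2 * Z p.1 p.2) * dz ψ p.1 p.2) p.1 :=
      (hZd.mul hZd).mul hψd
    show deriv (fun z' => (Z z' p.2 * Z z' p.2) * ψ z' p.2) p.1 = _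
    rw [hprod.deriv]
    simp only [Pi.mul_apply, uncurry_apply_pair]
    ring
  have h0 := hH.integral_dz_eq_zero
  rw [setIntegral_congr_fun measurableSet_strip hder, integral_add (h1.integrable.const_mul 2).integrableOn h2.integrable.integrableOn,
    MeasureTheory.integral_const_mul] at h0
  have e1 : ∫ p in strip, Z p.1 p.2 * dz Z p.1 p.2 * ψ p.1 p.2 = ∫ p in strip, (Z * dz Z) p.1 p.2 * uncurry ψ (p.1, p.2) :=
    setIntegral_congr_fun measurableSet_strip fun p _ => by simp only [Pi.mul_apply, uncurry_apply_pair]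
  have e2 : ∫ p in strip, Z p.1 p.2 ^ 2 * dz ψ p.1 p.2 = ∫ p in strip, (Z * Z) p.1 p.2 * uncurry (dz ψ) (p.1, p.2) :=
    setIntegral_congr_fun measurableSet_strip fun p _ => by simp only [Pi.mul_apply, uncurry_apply_pair, sq]
  rw [e1, e2]
  linarith

/-! ### The transport identities with the weights `w²sin(2θ)^{−c}` -/

/-- Smoothness of `(z, θ) ↦ w(z)²sin(2θ)^e` on the strip. [folklore] -/
theorem contDiffOn_weight_rpow (e : ℝ) : ContDiffOn ℝ ∞ (fun p : ℝ × ℝ => radialWeight p.1 ^ 2 * Real.sin (2 * p.2) ^ e) strip := by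
  refine ContDiffOn.mul ?_ ?_
  · unfold radialWeight
    exact ((contDiffOn_const.add contDiffOn_fst).pow 2).div (contDiffOn_fst.pow 2) (fun p hp => pow_ne_zero 2 (ne_of_gt hp.1)) |>.pow 2
  · intro p hp
    have hs : Real.sin (2 * p.2) ≠ 0 := (Real.sin_pos_of_pos_of_lt_pi (by linarith [hp.2.1]) (by linarith [hp.2.2])).ne'
    have h1 : ContDiffAt ℝ ∞ (fun q : ℝ × ℝ => Real.sin (2 * q.2)) p := by fun_prop
    exact (h1.rpow_const_of_ne hs).contDiffWithinAt

/-- **The `D_θ`-transport identity**: for test functions `u`, `Z`,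
`∫∫ u·D_θZ·Z·w²s^{−c} = −½∫∫ Z²w²s^{−c}(D_θu + 2(1−c)cos(2θ)u)`. [cite: Elgindi2021, §8.1 proof of Lemma 8.7 (p. 26 of arXiv:1904.04795)] -/
theorem integral_transport_Dθ {u Z : ℝ → ℝ → ℝ} (hu : StripTest u) (hZ : StripTest Z) (c : ℝ) :
    ∫ p in strip, u p.1 p.2 * Dθ Z p.1 p.2 * Z p.1 p.2 * radialWeight p.1 ^ 2 * Real.sin (2 * p.2) ^ (-c) =
      -(1 / 2) * ∫ p in strip, Z p.1 p.2 ^ 2 * radialWeight p.1 ^ 2 * Real.sin (2 * p.2) ^ (-c) *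
        (Dθ u p.1 p.2 + 2 * (1 - c) * Real.cos (2 * p.2) * u p.1 p.2) := by
  set ψ : ℝ → ℝ → ℝ := fun z θ => u z θ * (radialWeight z ^ 2 * Real.sin (2 * θ) ^ (1 - c)) with hψ
  have hψs : ContDiffOn ℝ ∞ (uncurry ψ) strip := by
    have : ContDiffOn ℝ ∞ (fun p : ℝ × ℝ => uncurry u p * (radialWeight p.1 ^ 2 * Real.sin (2 * p.2) ^ (1 - c))) strip :=
      (contDiff_infty.2 hu.smooth).contDiffOn.mul (contDiffOn_weight_rpow (1 - c))
    exact this.congr fun p _ => rfl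
  have hid := integral_mul_dθ_mul_eq hZ hψs
  -- the derivative of `ψ` in `θ` on the strip
  have hdψ : ∀ p ∈ strip, dθ ψ p.1 p.2 = radialWeight p.1 ^ 2 * Real.sin (2 * p.2) ^ (-c) * (Dθ u p.1 p.2 + 2 * (1 - c) * Real.cos (2 * p.2) * u p.1 p.2) := by
    intro p hp
    have hs : 0 < Real.sin (2 * p.2) := Real.sin_pos_of_pos_of_lt_pi (by linarith [hp.2.1]) (by linarith [hp.2.2])
    have hud : HasDerivAt (fun θ' => u p.1 θ') (dθ u p.1 p.2) p.2 := (((hu.slice_θ p.1).1.differentiable (by simp)) p.2).hasDerivAt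
    have hsin : HasDerivAt (fun θ' => Real.sin (2 * θ')) (Real.cos (2 * p.2) * (2 * 1)) p.2 :=
      (Real.hasDerivAt_sin (2 * p.2)).comp p.2 ((hasDerivAt_id p.2).const_mul 2)
    have hpow : HasDerivAt (fun θ' => Real.sin (2 * θ') ^ (1 - c)) ((1 - c) * Real.sin (2 * p.2) ^ (1 - c - 1) * (Real.cos (2 * p.2) * (2 * 1))) p.2 := by
      have := (Real.hasDerivAt_rpow_const (p := 1 - c) (x := Real.sin (2 * p.2)) (Or.inl hs.ne')).comp p.2 hsin
      exact this
    have hprod : HasDerivAt (fun θ' => ψ p.1 θ') (dθ u p.1 p.2 * (radialWeight p.1 ^ 2 * Real.sin (2 * p.2) ^ (1 - c)) +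
        u p.1 p.2 * (radialWeight p.1 ^ 2 * ((1 - c) * Real.sin (2 * p.2) ^ (1 - c - 1) * (Real.cos (2 * p.2) * (2 * 1))))) p.2 :=
      hud.mul (hpow.const_mul _)
    show deriv (fun θ' => ψ p.1 θ') p.2 = _
    rw [hprod.deriv, Dθ_apply, show deriv (fun θ' => u p.1 θ') p.2 = dθ u p.1 p.2 from rfl]
    have e1 : Real.sin (2 * p.2) ^ (1 - c) = Real.sin (2 * p.2) * Real.sin (2 * p.2) ^ (-c) := by
      rw [show (1 - c) = 1 + (-c) by ring, Real.rpow_add hs, Real.rpow_one]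
    have e2 : Real.sin (2 * p.2) ^ (1 - c - 1) = Real.sin (2 * p.2) ^ (-c) := by ring_nf
    rw [e1, e2]; ring
  have eL : ∫ p in strip, u p.1 p.2 * Dθ Z p.1 p.2 * Z p.1 p.2 * radialWeight p.1 ^ 2 * Real.sin (2 * p.2) ^ (-c) =
      ∫ p in strip, Z p.1 p.2 * dθ Z p.1 p.2 * ψ p.1 p.2 := by
    refine setIntegral_congr_fun measurableSet_strip fun p hp => ?_
    have hs : 0 < Real.sin (2 * p.2) := Real.sin_pos_of_pos_of_lt_pi (by linarith [hp.2.1]) (by linarith [hp.2.2])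
    simp only [hψ, Dθ_apply, show deriv (fun θ' => Z p.1 θ') p.2 = dθ Z p.1 p.2 from rfl]
    rw [show (1 - c) = 1 + (-c) by ring, Real.rpow_add hs, Real.rpow_one]; ring
  have eR : ∫ p in strip, Z p.1 p.2 ^ 2 * dθ ψ p.1 p.2 =
      ∫ p in strip, Z p.1 p.2 ^ 2 * radialWeight p.1 ^ 2 * Real.sin (2 * p.2) ^ (-c) * (Dθ u p.1 p.2 + 2 * (1 - c) * Real.cos (2 * p.2) * u p.1 p.2) := by
    refine setIntegral_congr_fun measurableSet_strip fun p hp => ?_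
    rw [hdψ p hp]; ring
  rw [eL, hid, eR]

/-- **The `D_z`-transport identity**: for test functions `v`, `Z`,
`∫∫ v·D_zZ·Z·w²s^{−c} = −½∫∫ Z²w²s^{−c}(D_zv + ((z−3)/(1+z))v)`. [cite: Elgindi2021, §8.1 Lemma 8.8 (p. 26 of arXiv:1904.04795)] -/
theorem integral_transport_Dz {v Z : ℝ → ℝ → ℝ} (hv : StripTest v) (hZ : StripTest Z) (c : ℝ) :
    ∫ p in strip, v p.1 p.2 * Dz Z p.1 p.2 * Z p.1 p.2 * radialWeight p.1 ^ 2 * Real.sin (2 * p.2) ^ (-c) =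
      -(1 / 2) * ∫ p in strip, Z p.1 p.2 ^ 2 * radialWeight p.1 ^ 2 * Real.sin (2 * p.2) ^ (-c) *
        (Dz v p.1 p.2 + (p.1 - 3) / (1 + p.1) * v p.1 p.2) := by
  set ψ : ℝ → ℝ → ℝ := fun z θ => v z θ * (z * radialWeight z ^ 2 * Real.sin (2 * θ) ^ (-c)) with hψ
  have hψs : ContDiffOn ℝ ∞ (uncurry ψ) strip := by
    have : ContDiffOn ℝ ∞ (fun p : ℝ × ℝ => uncurry v p * (p.1 * (radialWeight p.1 ^ 2 * Real.sin (2 * p.2) ^ (-c)))) strip :=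
      (contDiff_infty.2 hv.smooth).contDiffOn.mul (contDiffOn_fst.mul (contDiffOn_weight_rpow (-c)))
    refine this.congr fun p _ => ?_
    show v p.1 p.2 * (p.1 * radialWeight p.1 ^ 2 * Real.sin (2 * p.2) ^ (-c)) = _
    simp only [uncurry]; ring
  have hid := integral_mul_dz_mul_eq hZ hψs
  have hdψ : ∀ p ∈ strip, dz ψ p.1 p.2 = radialWeight p.1 ^ 2 * Real.sin (2 * p.2) ^ (-c) * (Dz v p.1 p.2 + (p.1 - 3) / (1 + p.1) * v p.1 p.2) := by
    intro p hp
    have hz : p.1 ≠ 0 := ne_of_gt hp.1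
    have hz1 : 1 + p.1 ≠ 0 := by have h : 0 < p.1 := hp.1; intro h'; linarith
    have hvd : HasDerivAt (fun z' => v z' p.2) (dz v p.1 p.2) p.1 := (((hv.slice_z p.2).1.differentiable (by simp)) p.1).hasDerivAt
    have hw := hasDerivAt_radialWeight hz
    have hw2 : HasDerivAt (fun z' => radialWeight z' ^ 2) (2 * radialWeight p.1 * (-2 * (1 + p.1) / p.1 ^ 3)) p.1 := by
      have e2 : (fun z' => radialWeight z' ^ 2) = fun z' => radialWeight z' * radialWeight z' := by funext z'; ring
      rw [e2]
      exact (hw.mul hw).congr_deriv (by ring)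
    have hm : HasDerivAt (fun z' => z' * radialWeight z' ^ 2 * Real.sin (2 * p.2) ^ (-c))
        ((1 * radialWeight p.1 ^ 2 + p.1 * (2 * radialWeight p.1 * (-2 * (1 + p.1) / p.1 ^ 3))) * Real.sin (2 * p.2) ^ (-c)) p.1 :=
      (((hasDerivAt_id p.1).mul hw2).mul_const _)
    have hprod : HasDerivAt (fun z' => ψ z' p.2) (dz v p.1 p.2 * (p.1 * radialWeight p.1 ^ 2 * Real.sin (2 * p.2) ^ (-c)) +
        v p.1 p.2 * ((1 * radialWeight p.1 ^ 2 + p.1 * (2 * radialWeight p.1 * (-2 * (1 + p.1) / p.1 ^ 3))) * Real.sin (2 * p.2) ^ (-c))) p.1 :=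
      hvd.mul hm
    show deriv (fun z' => ψ z' p.2) p.1 = _
    rw [hprod.deriv, Dz_apply, show deriv (fun z' => v z' p.2) p.1 = dz v p.1 p.2 from rfl]
    unfold radialWeight
    field_simp
    ring
  have eL : ∫ p in strip, v p.1 p.2 * Dz Z p.1 p.2 * Z p.1 p.2 * radialWeight p.1 ^ 2 * Real.sin (2 * p.2) ^ (-c) =
      ∫ p in strip, Z p.1 p.2 * dz Z p.1 p.2 * ψ p.1 p.2 := by
    refine setIntegral_congr_fun measurableSet_strip fun p _ => ?_
    simp only [hψ, Dz_apply, show deriv (fun z' => Z z' p.2) p.1 = dz Z p.1 p.2 from rfl]; ring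
  have eR : ∫ p in strip, Z p.1 p.2 ^ 2 * dz ψ p.1 p.2 =
      ∫ p in strip, Z p.1 p.2 ^ 2 * radialWeight p.1 ^ 2 * Real.sin (2 * p.2) ^ (-c) * (Dz v p.1 p.2 + (p.1 - 3) / (1 + p.1) * v p.1 p.2) := by
    refine setIntegral_congr_fun measurableSet_strip fun p hp => ?_
    rw [hdψ p hp]; ring
  rw [eL, hid, eR]

end Elgindi

end Literature.Analysis.FluidPDE
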